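/-
Copyright: lit-balaban Phase-2 proof seat p30 (gen 9).  Statement-level skeleton of a published paper; no proof claims beyond what
the kernel checks below.
-/
import Literature.MathematicalPhysics.QuantumFieldTheory.BalabanImbrieJaffe1984to88.BIJ85Ineq722DeltaA
import Literature.MathematicalPhysics.QuantumFieldTheory.Balaban1983to89.B5CoverP12Lattice
import Literature.MathematicalPhysics.QuantumFieldTheory.Balaban1983to89.B5SiteBridgeP12

/-!
# [BalabanImbrieJaffe1985] (7.2.2) ⇐ [6I] Prop. 1.2 — the DICTIONARY between the two typings of Proposition 1.2 on the torus (file 1 of 5)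

T. Bałaban, J. Imbrie, A. Jaffe, *Renormalization of the Higgs model: minimizers, propagators and the stability of mean field theory*,
Commun. Math. Phys. **97** (1985) 299–329 [BalabanImbrieJaffe1985], Sect. 7.2 p. 325: *"This inequality is a consequence of Proposition 1.2
and the representation (1.103) of [6I]"*; T. Bałaban, *Propagators and renormalization transformations for lattice gauge theories. I*,
Commun. Math. Phys. **95** (1984) 17–40 [Balaban1984PropagatorsI] = [6I], Prop. 1.2 (1.110)–(1.114) pp. 35–36.

THE KNITTING ITEM (rows C1.Eq7.2.1-7.2.2, C1.Eq7.2.4, C1.Eq7.3.1-7.3.2, C2.Eq2.16–2.19 of the lit-balaban skeleton).  Every torus theorem of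
the tree «given only [6I] Prop. 1.2 by name» consumes p09's encoding `B5.Prop12Printed (fun j => settingOf (torusRep P (lev j) (deltaAData
(hlev j) a)) j)` (carrier `BIJ85Ineq722ProofPart2.settingOf`: fine sites `Site P 0` of `Setup`, kernels `Gk hk a = Δ_a⁻¹`, `ℓ^∞/L^k` distances,
CENTRED size-2 cubes), whereas row B5.Prop1.2 is PROVED (p37 `B5Prop12GHolds.prop12_famG_printed`) for r02's real setting of record
`B5SettingP12Real.latticeSettingP12R n M a K` (fine torus `Tor (fine n M)`, unit torus `Tor M`, CORNER-centred closed cubes `Δ̃(y) = cubeT`).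
Both speak of the same operator: p09's `Gk hk a` IS, by definition (`BIJ85Ineq722DeltaA.Gk`), the real part of r02's `(DeltaA (L^k) (Mk P k) a)⁻¹`
read through p09's carrier identification `EK hk : Site P 0 ≃ Tor (fine (L^k) (Mk P k))` (`B5Eq117TorusCarriers`), and `Site P k` is
`Tor (Mk P k)`.  This file is the geometric dictionary along `EK` (file 1 of 5); `BIJ85Prop12TorusBridgePieces` has the kernels and the partition pieces,
`BIJ85Prop12TorusBridgeSup`/`…Holder` transfer the three genuine functionals of `settingOf`, and `BIJ85Prop12TorusBridge` does the index
surgery and states the hypothesis-free torus theorems.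

WHAT IS PROVED (0 `sorry`; standing range `k ≤ m + K`; one bookkeeping `def` with body: `cornerK`).
* §1 distances: `supDist` of `LatticeFieldCalculus` is r02's sup circular distance — `distU (L^k) Mk (EK x) (EK x′) = |x − x′|_∞/L^k = dS`
  (`distU_EK`), `distSite Mk y y′ = |y − y′|_∞ = dY` (`distSite_eq_supDist`);
* §2 blocks versus the two cube conventions: `EK x ∈ Δ̃(x_k)` (`EK_mem_cubeT_blk`); `x ∈ cube_{p09}(y) ⇒ |x_k − y|_∞ ≤ 1`
  (`supDist_blk_le_of_mem_cube`); `EK x ∈ Δ̃(y) ⇒ |x_k − y|_∞ ≤ 1` (`supDist_blk_le_of_mem_cubeT`);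
* §3 counting: `#{y : |y − y₀|_∞ ≤ r} ≤ (2r+2)^d` (`card_ball_le`);
(the kernels and the partition-of-unity pieces follow in `BIJ85Prop12TorusBridgePieces`).
statement-level skeleton of published theorems with citation tags; proofs where landed; nothing here is a claim about the Yang–Mills mass gap.
Unit `lit-balaban-p30` (literature-prover-lit-balaban-p30-g9-0), 2026-08-21.
-/

open scoped BigOperators Matrix

namespace Literature.MathematicalPhysics.QuantumFieldTheory.BalabanImbrieJaffe1984to88.BIJ85Prop12TorusBridgeGeom

open Balaban1983to89 hiding Site Plaq
open Balaban1983to89.LatticeFieldCalculus (supDist)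
open Balaban1983to89.B5Eq118OneStroke (iterBlockOf val_iterBlockOf)
open Balaban1983to89.B5Eq117TorusCarriers (Mk EK EK_apply EK_natCast)
open Balaban1983to89.B5Prop11Plancherel (Tor fine unitVec)
open Balaban1983to89.B5Prop12FieldsLattice (cdistF distU distSite toFine cubeT)
open Balaban1983to89.B5CoverP12Lattice (wP sum_wP mem_cubeT_of_wP_ne_zero wP_nonneg wP_le_one abs_wP_sub_le Lw Lw_nonneg)
open Balaban1983to89.B5DeltaA169 (DeltaA)
open BIJ85Ineq722Torus BIJ85Ineq722DeltaA
-- inside this namespace the bare `Site` is the `ℤ^d` carrier of the QFT root; the torus one is renamed: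
open Balaban1983to89 renaming Site → TSite

noncomputable section

variable {P : Params} {k : ℕ}

/-! ## §1  Distances -/

/-- `min(a, −a) = |a|` for the least-absolute-value representative on `ℤ/N`. [cite: Balaban1984PropagatorsI, (1.109) p.35] -/
theorem min_val_neg_val {N : ℕ} [NeZero N] (a : ZMod N) : min a.val (-a).val = a.valMinAbs.natAbs := by
  rw [ZMod.valMinAbs_natAbs_eq_min, ZMod.neg_val]
  split_ifs with h
  · subst h; simp
  · rfl

/-- `|x − y|_∞` of `LatticeFieldCalculus.supDist` as the sup of the circular coordinate distances `|valMinAbs|`.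
[cite: Balaban1982Higgs1, (1.3) p.604] -/
theorem supDist_eq_sup_natAbs {j : ℕ} (x y : TSite P j) :
    supDist x y = Finset.univ.sup fun μ => ((x μ - y μ).valMinAbs).natAbs := by
  unfold supDist
  congr 1
  funext μ
  rw [show y μ - x μ = -(x μ - y μ) from (neg_sub _ _).symm, min_val_neg_val]

/-- **`dY = |y − y′|_∞` is r02's `distSite`** on the unit torus `T₁^{(k)} = Site P k = Tor (Mk P k)`. [cite: Balaban1984PropagatorsI, (1.110) p.35] -/
theorem distSite_eq_supDist (y y' : TSite P k) : distSite (Mk P k) y y' = (supDist y y' : ℝ) := by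
  rw [supDist_eq_sup_natAbs]
  rfl

/-- `EK` preserves labels. [cite: Balaban1984PropagatorsI, (1.18) p.20] -/
theorem val_EK (hk : k ≤ P.m + P.K) (x : TSite P 0) (ν : Fin P.d) : (EK hk x ν).val = (x ν).val := by
  rw [EK_apply]; exact ZMod.ringEquivCongr_val _ _

/-- a cast between equal moduli preserves the least-absolute-value representative. [cite: Balaban1984PropagatorsI, (1.109) p.35] -/
theorem valMinAbs_ringEquivCongr {a b : ℕ} (h : a = b) (z : ZMod a) : (ZMod.ringEquivCongr h z).valMinAbs = z.valMinAbs := by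
  subst h; rw [ZMod.ringEquivCongr_refl_apply]

/-- `EK` preserves circular coordinate differences. [cite: Balaban1984PropagatorsI, (1.109) p.35] -/
theorem valMinAbs_EK_sub (hk : k ≤ P.m + P.K) (x x' : TSite P 0) (ν : Fin P.d) :
    (EK hk x ν - EK hk x' ν).valMinAbs = (x ν - x' ν).valMinAbs := by
  rw [EK_apply, EK_apply, ← map_sub, valMinAbs_ringEquivCongr]

/-- the fine circular coordinate distance through `EK`. [cite: Balaban1984PropagatorsI, (1.109) p.35] -/
theorem cdistF_EK (hk : k ≤ P.m + P.K) (x x' : TSite P 0) (μ : Fin P.d) :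
    cdistF (P.L ^ k) (Mk P k) (EK hk x) (EK hk x') μ = ((x μ - x' μ).valMinAbs).natAbs := by
  unfold cdistF; rw [valMinAbs_EK_sub]

/-- **`dS = |x − x′|_∞/L^k` is r02's `distU` through `EK`.** [cite: Balaban1984PropagatorsI, (1.109) p.35] -/
theorem distU_EK (hk : k ≤ P.m + P.K) (x x' : TSite P 0) :
    distU (P.L ^ k) (Mk P k) (EK hk x) (EK hk x') = (supDist x x' : ℝ) / (P.L : ℝ) ^ k := by
  unfold distU
  rw [supDist_eq_sup_natAbs, Finset.sup_congr rfl fun μ _ => cdistF_EK hk x x' μ]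
  push_cast
  rfl

/-- the same for p09's carrier distance `(torusRep P k D).dS`. [cite: BalabanImbrieJaffe1985, (7.2.2) p.325] -/
theorem dS_eq_distU (hk : k ≤ P.m + P.K) (D : TorusData P k) (x x' : TSite P 0) :
    (torusRep P k D).dS x x' = distU (P.L ^ k) (Mk P k) (EK hk x) (EK hk x') := by
  rw [torusRep_dS, distU_EK]

/-- `|x − x′|_∞ ≤ r` from coordinatewise fine circular distances `≤ r` read through `EK`. [cite: Balaban1984PropagatorsI, (1.109) p.35] -/
theorem supDist_le_of_cdistF_le (hk : k ≤ P.m + P.K) {x x' : TSite P 0} {r : ℕ}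
    (h : ∀ μ, cdistF (P.L ^ k) (Mk P k) (EK hk x) (EK hk x') μ ≤ r) : supDist x x' ≤ r := by
  rw [supDist_eq_sup_natAbs]
  exact Finset.sup_le fun μ _ => by rw [← cdistF_EK hk]; exact h μ

/-! ## §2  Blocks and the two cube conventions -/

/-- **every fine site lies in the doubled cube of its own block**: `EK x ∈ Δ̃(x_k)` (`Δ̃` = r02's `cubeT`, radius `L^k` around the corner
`L^k·x_k`; the offset of `x` in its block is `< L^k`). [cite: Balaban1984PropagatorsI, p.35] -/
theorem EK_mem_cubeT_blk (hk : k ≤ P.m + P.K) (x : TSite P 0) : EK hk x ∈ cubeT (P.L ^ k) (Mk P k) (iterBlockOf k x) := by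
  rw [cubeT, Finset.mem_filter]
  refine ⟨Finset.mem_univ _, fun μ => ?_⟩
  have hn : 0 < P.L ^ k := pow_pos P.L_pos k
  have hv : (toFine (P.L ^ k) (Mk P k) (iterBlockOf k x) μ).val = P.L ^ k * ((x μ).val / P.L ^ k) := by
    rw [B5SiteBridgeP12.toFine_val, val_iterBlockOf k hk]
  have hle : (toFine (P.L ^ k) (Mk P k) (iterBlockOf k x) μ).val ≤ (EK hk x μ).val := by
    rw [hv, val_EK]; exact Nat.mul_div_le _ _
  unfold cdistF
  refine (by rw [ZMod.valMinAbs_natAbs_eq_min]; exact min_le_left _ _ :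
    (EK hk x μ - toFine (P.L ^ k) (Mk P k) (iterBlockOf k x) μ).valMinAbs.natAbs ≤
      (EK hk x μ - toFine (P.L ^ k) (Mk P k) (iterBlockOf k x) μ).val).trans ?_
  rw [ZMod.val_sub hle, hv, val_EK]
  have := Nat.div_add_mod (x μ).val (P.L ^ k)
  have := Nat.mod_lt (x μ).val hn
  omega

/-- the `k`-block of a block centre is the block. [cite: Balaban1987RG1, (0.1) p.252] -/
theorem iterBlockOf_ctr (hk : k ≤ P.m + P.K) (y : TSite P k) : iterBlockOf k (ctr k y) = y := by
  funext μ
  apply ZMod.val_injective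
  have hn : 0 < P.L ^ k := pow_pos P.L_pos k
  rw [val_iterBlockOf k hk, val_ctr hk, mul_comm, Nat.mul_add_div hn, Nat.div_eq_of_lt (by omega), add_zero]

/-- **a fine site of p09's centred cube `cube(y) = {|x − ctr y|_∞ < L^k}` has its block within one unit of `y`.**
[cite: BalabanImbrieJaffe1985, (5.1.2)–(5.1.3) p.313] -/
theorem supDist_blk_le_of_mem_cube (hk : k ≤ P.m + P.K) {D : TorusData P k} {x : TSite P 0} {y : TSite P k}
    (h : x ∈ (torusRep P k D).cube y) : supDist (iterBlockOf k x) y ≤ 1 := by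
  rw [mem_cube_iff, div_lt_one (pow_pos P.cast_L_pos k)] at h
  have h' : supDist x (ctr k y) < P.L ^ k := by exact_mod_cast h
  have h1 := mul_supDist_blk_le hk x (ctr k y)
  rw [iterBlockOf_ctr hk] at h1
  by_contra h2
  have h3 : P.L ^ k * 2 ≤ P.L ^ k * supDist (iterBlockOf k x) y := Nat.mul_le_mul_left _ (by omega)
  omega

/-- the corner `L^k·y` of the block `B^k(y)` as a fine site of `Setup`. [cite: Balaban1984PropagatorsI, (1.6) p.18] -/
def cornerK (k : ℕ) (y : TSite P k) : TSite P 0 := fun μ => ((P.L ^ k * (y μ).val : ℕ) : ZMod (P.sitesPerDir 0))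

/-- labels of the corner. [cite: Balaban1984PropagatorsI, (1.6) p.18] -/
theorem val_cornerK (hk : k ≤ P.m + P.K) (y : TSite P k) (μ : Fin P.d) : (cornerK k y μ).val = P.L ^ k * (y μ).val := by
  simp only [cornerK]
  rw [ZMod.val_natCast, Nat.mod_eq_of_lt]
  rw [BIJ85Ineq722Torus.sitesPerDir_zero_eq hk, mul_comm (P.sitesPerDir k) (P.L ^ k)]
  exact Nat.mul_lt_mul_of_pos_left (ZMod.val_lt (y μ)) (pow_pos P.L_pos k)

/-- `EK` of the corner is r02's `toFine`. [cite: Balaban1984PropagatorsI, (1.6) p.18] -/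
theorem EK_cornerK (hk : k ≤ P.m + P.K) (y : TSite P k) : EK hk (cornerK k y) = toFine (P.L ^ k) (Mk P k) y := by
  have h := EK_natCast hk (fun μ => P.L ^ k * (y μ).val)
  unfold cornerK
  rw [h]
  funext μ
  simp only [toFine, Int.cast_natCast]

/-- the block of the corner is the block. [cite: Balaban1984PropagatorsI, (1.6) p.18] -/
theorem iterBlockOf_cornerK (hk : k ≤ P.m + P.K) (y : TSite P k) : iterBlockOf k (cornerK k y) = y := by
  funext μ
  apply ZMod.val_injective
  rw [val_iterBlockOf k hk, val_cornerK hk, Nat.mul_div_cancel_left _ (pow_pos P.L_pos k)]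

/-- **a fine site of r02's doubled cube `Δ̃(y) = cubeT y` has its block within one unit of `y`.** [cite: Balaban1984PropagatorsI, p.35] -/
theorem supDist_blk_le_of_mem_cubeT (hk : k ≤ P.m + P.K) {x : TSite P 0} {y : TSite P k}
    (h : EK hk x ∈ cubeT (P.L ^ k) (Mk P k) y) : supDist (iterBlockOf k x) y ≤ 1 := by
  rw [cubeT, Finset.mem_filter, ← EK_cornerK hk] at h
  have h0 : supDist x (cornerK k y) ≤ P.L ^ k := supDist_le_of_cdistF_le hk h.2
  have h1 := mul_supDist_blk_le hk x (cornerK k y)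
  rw [iterBlockOf_cornerK hk] at h1
  have hn : 0 < P.L ^ k := pow_pos P.L_pos k
  by_contra h2
  have h3 : P.L ^ k * 2 ≤ P.L ^ k * supDist (iterBlockOf k x) y := Nat.mul_le_mul_left _ (by omega)
  omega

/-! ## §3  Counting unit sites in an `ℓ^∞` ball -/

/-- **`#{y : |y − y₀|_∞ ≤ r} ≤ (2r + 2)^d`** on every torus of `Setup`. [cite: Balaban1984PropagatorsI, (1.115) p.36] -/
theorem card_ball_le {j : ℕ} (y₀ : TSite P j) (r : ℕ) :
    (Finset.univ.filter fun y : TSite P j => supDist y y₀ ≤ r).card ≤ (2 * r + 2) ^ P.d := by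
  classical
  -- encode `y` by the coordinatewise data «`(y − y₀)_μ` or `(y₀ − y)_μ`, whichever is `≤ r`»
  let f : TSite P j → (Fin P.d → Fin (r + 1) ⊕ Fin (r + 1)) := fun y μ =>
    if h : (y μ - y₀ μ).val ≤ r then Sum.inl ⟨(y μ - y₀ μ).val, Nat.lt_succ_of_le h⟩
    else if h' : (y₀ μ - y μ).val ≤ r then Sum.inr ⟨(y₀ μ - y μ).val, Nat.lt_succ_of_le h'⟩ else Sum.inl ⟨0, Nat.succ_pos r⟩
  have hinj : Set.InjOn f ↑(Finset.univ.filter fun y : TSite P j => supDist y y₀ ≤ r) := by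
    intro y hy y' hy' hff
    simp only [Finset.coe_filter, Finset.mem_univ, true_and, Set.mem_setOf_eq] at hy hy'
    funext μ
    have hμ : min (y μ - y₀ μ).val (y₀ μ - y μ).val ≤ r :=
      (Finset.le_sup (f := fun μ => min (y μ - y₀ μ).val (y₀ μ - y μ).val) (Finset.mem_univ μ)).trans hy
    have hμ' : min (y' μ - y₀ μ).val (y₀ μ - y' μ).val ≤ r :=
      (Finset.le_sup (f := fun μ => min (y' μ - y₀ μ).val (y₀ μ - y' μ).val) (Finset.mem_univ μ)).trans hy'
    have hf := congrFun hff μ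
    simp only [f] at hf
    by_cases h1 : (y μ - y₀ μ).val ≤ r
    · rw [dif_pos h1] at hf
      by_cases h1' : (y' μ - y₀ μ).val ≤ r
      · rw [dif_pos h1'] at hf
        have := ZMod.val_injective _ (Fin.mk.inj (Sum.inl.inj hf))
        exact sub_left_injective this
      · rw [dif_neg h1'] at hf
        by_cases h2' : (y₀ μ - y' μ).val ≤ r
        · rw [dif_pos h2'] at hf; exact absurd hf Sum.inl_ne_inr
        · exact absurd hμ' (by rw [not_le, lt_min_iff]; exact ⟨not_le.mp h1', not_le.mp h2'⟩)
    · rw [dif_neg h1] at hf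
      have h2 : (y₀ μ - y μ).val ≤ r := by
        by_contra h2; exact absurd hμ (by rw [not_le, lt_min_iff]; exact ⟨not_le.mp h1, not_le.mp h2⟩)
      rw [dif_pos h2] at hf
      by_cases h1' : (y' μ - y₀ μ).val ≤ r
      · rw [dif_pos h1'] at hf; exact absurd hf Sum.inr_ne_inl
      · rw [dif_neg h1'] at hf
        by_cases h2' : (y₀ μ - y' μ).val ≤ r
        · rw [dif_pos h2'] at hf
          have := ZMod.val_injective _ (Fin.mk.inj (Sum.inr.inj hf))
          exact sub_right_injective this
        · exact absurd hμ' (by rw [not_le, lt_min_iff]; exact ⟨not_le.mp h1', not_le.mp h2'⟩)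
  have h := Finset.card_le_card_of_injOn f (fun _ _ => Finset.mem_coe.2 (Finset.mem_univ _)) hinj
  refine h.trans ?_
  rw [Finset.card_univ, Fintype.card_pi, Finset.prod_const, Finset.card_univ, Fintype.card_fin, Fintype.card_sum,
    Fintype.card_fin]
  apply Nat.pow_le_pow_left
  omega

end

end Literature.MathematicalPhysics.QuantumFieldTheory.BalabanImbrieJaffe1984to88.BIJ85Prop12TorusBridgeGeom
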